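import Mathlib
import HarnessLib
import Summits.Ventures.LatticeQCDFlow.Scoring.GaussianCochranReduction

/-!
# THE LIMIT LAW OF THE `k`-ARM HOMOGENEITY STATISTIC: FOR INDEPENDENT `Z_r ∼ N(0, s_r)`,
# `P(Σ_r (Z_r − m̂)²/s_r ≤ c) = N^{⊗R}{Σ_{r≠0} w_r² ≤ c}`, AND ITS LEVEL SETS ARE NULL

HONEST FRAMING: exact (Metropolis-corrected) sampling algorithms for lattice gauge theory;
figures of merit are autocorrelation/cost numbers at stated couplings and volumes; no
continuum-physics claim.

Venture `LatticeQCDFlow` (cell pub-lqcd), topic `Scoring`; FANOUT row 4 (`s0-u1-b`, GEN-33).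
NEW WORK of the cell (classical), no definition, nothing cited as a fact.

WHY (row 4).  The chain-level `k`-arm homogeneity theorem (`Scoring/KArmHomogeneityCoverage`)
converges, by Slutsky and portmanteau, to the random variable `Σ_r (Z_r − m̂(Z))²/s_r` built from the
independent Gaussian limits `Z_r ∼ N(0, s_r)` of the `R` arms (`m̂` the inverse-variance mean).  This
file identifies its law with the variance-free Gaussian functional of
`Scoring/GaussianCochranReduction` — `P'(Σ_r (Z_r − m̂)²/s_r ∈ B) = N(0,1)^{⊗R}{z | Σ_{r≠0} z_r² ∈ B}`
for every Borel `B` — and proves the level sets `{Σ_{r≠0} z_r² = c}` null for `R ≥ 2` (sections in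
one further coordinate have at most two points), so that `{· ≤ c}` is a continuity set.

## Content

* `pi_gaussianReal_cochran_preimage_eq` (§1) — Borel-set version of Cochran's reduction.
* `hasLaw_standardise_pi` (§2) — `(Z_r/√s_r)_r` has law `N(0,1)^{⊗R}` on `P'`.
* **`measure_homogeneity_limit_preimage_eq`** (§2) — the law identity for every Borel `B`.
* **`pi_gaussianReal_sum_sq_erase_levelSet_eq_zero`** (§3) — `N^{⊗(n+2)}{Σ_{r≠0} z_r² = c} = 0`;
  `pi_gaussianReal_sum_sq_erase_two` — `R = 2`: the reduced event has probability `N(0,1)([−√c, √c])`;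
  `measure_homogeneity_limit_levelSet_eq_zero` — hence `P'(Σ_r (Z_r − m̂)²/s_r = c) = 0`.

Depends on `Scoring/GaussianCochranReduction` (row 4 GEN-33) and Mathlib.  [ours] throughout.
-/

open MeasureTheory ProbabilityTheory Filter Topology Finset

namespace Summit.Ventures.LatticeQCDFlow.Scoring

open Set WithLp
open scoped RealInnerProductSpace

/-! ## §1 Cochran's reduction for arbitrary Borel sets -/

section Borel

variable {ι : Type*} [Fintype ι] [DecidableEq ι]

/-- Borel-set version of `pi_gaussianReal_cochran_eq_erase`: for `Σ_i u_i² = 1`, every `r₀` and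
every measurable `B ⊆ ℝ`,
`N^{⊗ι}{z | Σ_i z_i² − (Σ_i u_i z_i)² ∈ B} = N^{⊗ι}{z | Σ_{r≠r₀} z_r² ∈ B}`. [ours] -/
theorem pi_gaussianReal_cochran_preimage_eq (u : ι → ℝ) (hu : ∑ i, u i ^ 2 = 1) (r₀ : ι)
    {B : Set ℝ} (hB : MeasurableSet B) :
    (Measure.pi fun _ : ι => gaussianReal 0 1)
        {z : ι → ℝ | ∑ i, z i ^ 2 - (∑ i, u i * z i) ^ 2 ∈ B}
      = (Measure.pi fun _ : ι => gaussianReal 0 1) {z : ι → ℝ | ∑ r ∈ univ.erase r₀, z r ^ 2 ∈ B} := by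
  set uE : EuclideanSpace ℝ ι := toLp 2 u with huE
  have hnu : ‖uE‖ = 1 := by
    have h2 : ‖uE‖ ^ 2 = 1 := by
      rw [EuclideanSpace.real_norm_sq_eq]; simpa [huE] using hu
    nlinarith [h2, norm_nonneg uE]
  set O := ((ℝ ∙ (uE - EuclideanSpace.single r₀ (1 : ℝ)))ᗮ).reflection with hO
  have hmp := measurePreserving_euclidean_isometry_pi (ι := ι) O
  have hBm : MeasurableSet {z : ι → ℝ | ∑ r ∈ univ.erase r₀, z r ^ 2 ∈ B} :=
    (by fun_prop : Measurable fun z : ι → ℝ => ∑ r ∈ univ.erase r₀, z r ^ 2) hB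
  have hpre : {z : ι → ℝ | ∑ i, z i ^ 2 - (∑ i, u i * z i) ^ 2 ∈ B}
      = (fun z : ι → ℝ => ofLp (O (toLp 2 z))) ⁻¹' {z : ι → ℝ | ∑ r ∈ univ.erase r₀, z r ^ 2 ∈ B} := by
    ext z
    simp only [Set.mem_setOf_eq, Set.mem_preimage]
    have h := sum_sq_erase_reflection_unit uE hnu r₀ (toLp 2 z)
    rw [← hO] at h
    have h' : ∑ r ∈ univ.erase r₀, (ofLp (O (toLp 2 z))) r ^ 2 = ‖(toLp 2 z : EuclideanSpace ℝ ι)‖ ^ 2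
        - ⟪(toLp 2 z : EuclideanSpace ℝ ι), uE⟫ ^ 2 := by simpa using h
    rw [h', EuclideanSpace.real_norm_sq_eq, huE, inner_toLp_toLp_eq_sum]
  rw [hpre, ← Measure.map_apply hmp.measurable hBm, hmp.map_eq]

/-- Borel-set version of `pi_gaussianReal_homogeneity_eq_erase` (`σ_i > 0`). [ours] -/
theorem pi_gaussianReal_homogeneity_preimage_eq (μ : ℝ) (σ : ι → ℝ) (hσ : ∀ i, 0 < σ i) (r₀ : ι)
    {B : Set ℝ} (hB : MeasurableSet B) :
    (Measure.pi fun _ : ι => gaussianReal 0 1)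
        {z : ι → ℝ | ∑ i, ((μ + σ i * z i) - (∑ j, (μ + σ j * z j) / σ j ^ 2) / (∑ j, (σ j ^ 2)⁻¹)) ^ 2
          / σ i ^ 2 ∈ B}
      = (Measure.pi fun _ : ι => gaussianReal 0 1) {z : ι → ℝ | ∑ r ∈ univ.erase r₀, z r ^ 2 ∈ B} := by
  have hne : Nonempty ι := ⟨r₀⟩
  set W := ∑ i, (σ i ^ 2)⁻¹ with hWdef
  have hW : 0 < W := Finset.sum_pos (fun i _ => by have := hσ i; positivity) Finset.univ_nonempty
  set u : ι → ℝ := fun i => (σ i)⁻¹ / Real.sqrt W with hu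
  have hu1 : ∑ i, u i ^ 2 = 1 := by
    simp only [hu, div_pow, inv_pow, Real.sq_sqrt hW.le]
    rw [← Finset.sum_div, ← hWdef, div_self hW.ne']
  have hset : {z : ι → ℝ | ∑ i, ((μ + σ i * z i) - (∑ j, (μ + σ j * z j) / σ j ^ 2) / (∑ j, (σ j ^ 2)⁻¹)) ^ 2
          / σ i ^ 2 ∈ B} = {z : ι → ℝ | ∑ i, z i ^ 2 - (∑ i, u i * z i) ^ 2 ∈ B} := by
    ext z
    simp only [Set.mem_setOf_eq]
    rw [homogeneity_statistic_eq μ σ z (fun i => (hσ i).ne') hW.ne']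
    have hS : (∑ i, u i * z i) ^ 2 = (∑ i, z i / σ i) ^ 2 / W := by
      have : ∑ i, u i * z i = (∑ i, z i / σ i) / Real.sqrt W := by
        rw [Finset.sum_div]
        refine Finset.sum_congr rfl fun i _ => ?_
        simp only [hu]
        field_simp
      rw [this, div_pow, Real.sq_sqrt hW.le]
    rw [hS]
  rw [hset]
  exact pi_gaussianReal_cochran_preimage_eq u hu1 r₀ hB

end Borel

/-! ## §2 The limit random variable of the `k`-arm statistic has the reduced law -/

section LimitLaw

variable {R : ℕ} {Ω' : Type*} [MeasurableSpace Ω'] {P' : Measure Ω'} [IsProbabilityMeasure P']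

/-- Independent `Z_r ∼ N(0, s_r)` (`s_r > 0` the variances): the standardised vector
`(Z_r/√s_r)_r` has law `N(0,1)^{⊗R}`. [ours] -/
theorem hasLaw_standardise_pi {Z : Fin R → Ω' → ℝ} {s : Fin R → ℝ} (hs : ∀ r, 0 < s r)
    (hZm : ∀ r, Measurable (Z r)) (hZ : ∀ r, HasLaw (Z r) (gaussianReal 0 (s r).toNNReal) P')
    (hind : iIndepFun Z P') :
    HasLaw (fun ω' (r : Fin R) => Z r ω' / Real.sqrt (s r)) (Measure.pi fun _ : Fin R => gaussianReal 0 1) P' := by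
  have h1 : ∀ r, HasLaw (fun ω' => Z r ω' / Real.sqrt (s r)) (gaussianReal 0 1) P' := by
    intro r
    have h := gaussianReal_div_const (hZ r) (Real.sqrt (s r))
    rw [zero_div] at h
    convert h using 2
    apply NNReal.eq
    rw [NNReal.coe_div, Real.coe_toNNReal _ (hs r).le, NNReal.coe_mk, Real.sq_sqrt (hs r).le,
      NNReal.coe_one, div_self (hs r).ne']
  have hind' : iIndepFun (fun r ω' => Z r ω' / Real.sqrt (s r)) P' :=
    hind.comp (fun r x => x / Real.sqrt (s r)) fun r => measurable_id.div_const _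
  have hmeas : ∀ r, AEMeasurable (fun ω' => Z r ω' / Real.sqrt (s r)) P' :=
    fun r => ((hZm r).div_const _).aemeasurable
  refine ⟨(measurable_pi_lambda _ fun r => (hZm r).div_const _).aemeasurable, ?_⟩
  rw [(iIndepFun_iff_map_fun_eq_pi_map hmeas).1 hind']
  congr 1
  funext r
  exact (h1 r).map_eq

/-- **THE LAW OF THE LIMIT STATISTIC**: for independent `Z_r ∼ N(0, s_r)` (`s_r > 0`), every
Borel `B` and `R ≥ 1`,
`P'(Σ_r (Z_r − m̂)²/s_r ∈ B) = N(0,1)^{⊗R}{z | Σ_{r≠0} z_r² ∈ B}`, `m̂ = (Σ_r Z_r/s_r)/(Σ_r 1/s_r)`. [ours] -/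
theorem measure_homogeneity_limit_preimage_eq [NeZero R] {Z : Fin R → Ω' → ℝ} {s : Fin R → ℝ}
    (hs : ∀ r, 0 < s r) (hZm : ∀ r, Measurable (Z r))
    (hZ : ∀ r, HasLaw (Z r) (gaussianReal 0 (s r).toNNReal) P') (hind : iIndepFun Z P')
    {B : Set ℝ} (hB : MeasurableSet B) :
    P' {ω' | ∑ r, (Z r ω' - (∑ j, Z j ω' / s j) / (∑ j, (s j)⁻¹)) ^ 2 / s r ∈ B}
      = (Measure.pi fun _ : Fin R => gaussianReal 0 1)
        {z : Fin R → ℝ | ∑ r ∈ univ.erase 0, z r ^ 2 ∈ B} := by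
  have hlaw := hasLaw_standardise_pi hs hZm hZ hind
  set σ : Fin R → ℝ := fun r => Real.sqrt (s r) with hσ
  have hσpos : ∀ r, 0 < σ r := fun r => Real.sqrt_pos.2 (hs r)
  have hσsq : ∀ r, σ r ^ 2 = s r := fun r => Real.sq_sqrt (hs r).le
  -- the statistic is the homogeneity statistic of `x_r = 0 + σ_r w_r` at `w = Z/σ`
  set A : Set (Fin R → ℝ) := {z : Fin R → ℝ | ∑ i, ((0 + σ i * z i)
      - (∑ j, (0 + σ j * z j) / σ j ^ 2) / (∑ j, (σ j ^ 2)⁻¹)) ^ 2 / σ i ^ 2 ∈ B} with hA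
  have hAm : MeasurableSet A := by
    simp only [hA]
    exact (by fun_prop : Measurable fun z : Fin R → ℝ => ∑ i, ((0 + σ i * z i)
      - (∑ j, (0 + σ j * z j) / σ j ^ 2) / (∑ j, (σ j ^ 2)⁻¹)) ^ 2 / σ i ^ 2) hB
  have hpre : {ω' | ∑ r, (Z r ω' - (∑ j, Z j ω' / s j) / (∑ j, (s j)⁻¹)) ^ 2 / s r ∈ B}
      = (fun ω' (r : Fin R) => Z r ω' / Real.sqrt (s r)) ⁻¹' A := by
    ext ω'
    simp only [hA, Set.mem_setOf_eq, Set.mem_preimage, zero_add]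
    have hx : ∀ r, σ r * (Z r ω' / Real.sqrt (s r)) = Z r ω' := fun r => by
      have hsr : Real.sqrt (s r) ≠ 0 := (Real.sqrt_pos.2 (hs r)).ne'
      simp only [hσ]
      field_simp
    simp only [hx, hσsq]
  rw [hpre, ← Measure.map_apply_of_aemeasurable hlaw.aemeasurable hAm, hlaw.map_eq, hA]
  exact pi_gaussianReal_homogeneity_preimage_eq 0 σ hσpos 0 hB

end LimitLaw

/-! ## §3 Level sets of `Σ_{r≠0} z_r²` are Gaussian-null (`R ≥ 2`) -/

section LevelSet

/-- **`N(0,1)^{⊗(n+2)}{z | Σ_{r≠0} z_r² = c} = 0`** for every `c`: split off coordinate `1`; each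
section `{x | x² + C = c}` has at most two points. [ours] -/
theorem pi_gaussianReal_sum_sq_erase_levelSet_eq_zero (n : ℕ) (c : ℝ) :
    (Measure.pi fun _ : Fin (n + 2) => gaussianReal 0 1)
      {z : Fin (n + 2) → ℝ | ∑ r ∈ univ.erase 0, z r ^ 2 = c} = 0 := by
  set γ : Measure ℝ := gaussianReal 0 1 with hγ
  haveI : NullSingletonClass (gaussianReal (0 : ℝ) 1) := nullSingletonClass_gaussianReal one_ne_zero
  have hmp := measurePreserving_piFinSuccAbove (fun _ : Fin (n + 2) => γ) 1
  -- the sum over `r ≠ 0` is `z 1 ^ 2 + (sum over the remaining coordinates ≠ 0)`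
  set B : Set (ℝ × (Fin (n + 1) → ℝ)) :=
    {p | p.1 ^ 2 + ∑ j ∈ univ.erase 0, p.2 j ^ 2 = c} with hB
  have hBm : MeasurableSet B := measurableSet_eq_fun (by fun_prop) (by fun_prop)
  have hsum : ∀ z : Fin (n + 2) → ℝ, ∑ r ∈ univ.erase 0, z r ^ 2
      = z 1 ^ 2 + ∑ j ∈ univ.erase (0 : Fin (n + 1)), z ((1 : Fin (n + 2)).succAbove j) ^ 2 := by
    intro z
    rw [Finset.sum_erase_eq_sub (Finset.mem_univ _), Fin.sum_univ_succAbove _ 1,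
      Finset.sum_erase_eq_sub (Finset.mem_univ _), Fin.one_succAbove_zero]
    ring
  have hpre : {z : Fin (n + 2) → ℝ | ∑ r ∈ univ.erase 0, z r ^ 2 = c}
      = MeasurableEquiv.piFinSuccAbove (fun _ : Fin (n + 2) => ℝ) 1 ⁻¹' B := by
    ext z
    simp only [Set.mem_setOf_eq, Set.mem_preimage, hB, MeasurableEquiv.piFinSuccAbove_apply,
      Fin.insertNthEquiv, Equiv.coe_fn_symm_mk, Fin.removeNth, hsum z]
  rw [hpre, ← Measure.map_apply (MeasurableEquiv.measurable _) hBm, hmp.map_eq,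
    Measure.prod_apply_symm hBm]
  have hsec : ∀ w : Fin (n + 1) → ℝ, γ ((fun x : ℝ => (x, w)) ⁻¹' B) = 0 := fun w => by
    set C := ∑ j ∈ univ.erase 0, w j ^ 2
    have hsub : (fun x : ℝ => (x, w)) ⁻¹' B ⊆ {Real.sqrt (c - C), -Real.sqrt (c - C)} := by
      intro x hx
      simp only [hB, Set.mem_preimage, Set.mem_setOf_eq] at hx
      have hx2 : x ^ 2 = c - C := by linarith
      have h' : |x| = Real.sqrt (c - C) := by rw [← Real.sqrt_sq_eq_abs, hx2]
      rcases abs_eq (Real.sqrt_nonneg _) |>.1 h' with h1 | h1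
      · exact Or.inl h1
      · exact Or.inr h1
    exact measure_mono_null hsub ((Set.toFinite _).measure_zero γ)
  refine (lintegral_congr fun w => ?_).trans lintegral_zero
  exact hsec w

/-- **Two arms**: `N(0,1)^{⊗2}{z | Σ_{r≠0} z_r² ≤ c} = N(0,1)([−√c, √c])` for `c ≥ 0` — with `R = 2` the
homogeneity statistic is the SQUARE of the `σ_comb` statistic and its calibration is the two-sided
normal one (consistency with `Scoring/TwoCodeAgreement*`). [ours] -/
theorem pi_gaussianReal_sum_sq_erase_two {c : ℝ} (hc : 0 ≤ c) :
    (Measure.pi fun _ : Fin 2 => gaussianReal 0 1) {z : Fin 2 → ℝ | ∑ r ∈ univ.erase 0, z r ^ 2 ≤ c}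
      = (gaussianReal 0 1) (Icc (-Real.sqrt c) (Real.sqrt c)) := by
  have hset : {z : Fin 2 → ℝ | ∑ r ∈ univ.erase 0, z r ^ 2 ≤ c}
      = (fun z : Fin 2 → ℝ => z 1) ⁻¹' Icc (-Real.sqrt c) (Real.sqrt c) := by
    ext z
    have h2 : ∑ r ∈ univ.erase (0 : Fin 2), z r ^ 2 = z 1 ^ 2 := by
      rw [Finset.sum_erase_eq_sub (Finset.mem_univ _), Fin.sum_univ_two]; ring
    simp only [Set.mem_setOf_eq, h2, Set.mem_preimage, Set.mem_Icc]
    constructor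
    · intro h
      have : |z 1| ≤ Real.sqrt c := by
        rw [← Real.sqrt_sq_eq_abs]; exact Real.sqrt_le_sqrt h
      exact abs_le.1 this
    · intro h
      have h' : |z 1| ≤ Real.sqrt c := abs_le.2 h
      have := sq_le_sq' (abs_le.1 h').1 (abs_le.1 h').2
      rwa [Real.sq_sqrt hc] at this
  rw [hset, ← Measure.map_apply (measurable_pi_apply 1) measurableSet_Icc,
    (measurePreserving_eval (fun _ : Fin 2 => gaussianReal 0 1) 1).map_eq]


variable {Ω' : Type*} [MeasurableSpace Ω'] {P' : Measure Ω'} [IsProbabilityMeasure P']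

/-- **The limit statistic has no atoms**: for independent `Z_r ∼ N(0, s_r)` with `R = n + 2 ≥ 2`
arms, `P'(Σ_r (Z_r − m̂)²/s_r = c) = 0` for every `c`. [ours] -/
theorem measure_homogeneity_limit_levelSet_eq_zero {n : ℕ} {Z : Fin (n + 2) → Ω' → ℝ}
    {s : Fin (n + 2) → ℝ} (hs : ∀ r, 0 < s r) (hZm : ∀ r, Measurable (Z r))
    (hZ : ∀ r, HasLaw (Z r) (gaussianReal 0 (s r).toNNReal) P') (hind : iIndepFun Z P') (c : ℝ) :
    P' {ω' | ∑ r, (Z r ω' - (∑ j, Z j ω' / s j) / (∑ j, (s j)⁻¹)) ^ 2 / s r = c} = 0 := by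
  have h := measure_homogeneity_limit_preimage_eq hs hZm hZ hind (measurableSet_singleton c)
  simp only [Set.mem_singleton_iff] at h
  rw [h]
  exact pi_gaussianReal_sum_sq_erase_levelSet_eq_zero n c

end LevelSet

end Summit.Ventures.LatticeQCDFlow.Scoring
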